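/-
Copyright: the b2b-balaban T⁴-continuum CRUX team, row NE7b OWNER lineage `t4-ne7b-p1` (gen 135). Project licence.
-/
import Summits.QuantumFields.BalabanUV.T4Continuum.Spine.NE7b.SupVacuumNormalisation

/-!
# AFTER QUADRATIC EXTRACTION THE STABILITY RATE IS PROPORTIONAL TO THE RADIUS — (α4)'s ENTRY, ALGEBRAIC HALF: if the residual
# `R(ψ) := W(ψ) − W(0) − ⟨b,ψ⟩ − ½⟨ψ,Kψ⟩` of the next potential has the CUBIC letter of (338)∕(339) on the small-field ball,
#   `‖R(ψ)‖ ≤ C₃·Ψ·Q(ψ)` and `‖R(ψ)‖ ≤ C₃Ψ³` for `Q(ψ) := Σ_{cells D}ψ² ≤ Ψ²`,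
# then the quadratically-extracted factor `1 + ĝ := e^{−R}` has, ON THE BALL, exactly (290)'s two primary letters
#   (S) `‖e^{−R(ψ)} − 1‖ ≤ 2C₃Ψ³` (when `C₃Ψ³ ≤ 1`),   (L1) `‖e^{−R(ψ)}‖ ≤ e^{½(2C₃Ψ)·Q(ψ)}`:
# the residual stability RATE is `2C₃Ψ` — proportional to the small-field radius and the cubic letter, NOT inherited from the previous scale.
# This is how the located obstruction (d7′)(2′) («the small stability rate must fall like the inverse field operator norm») is met IN FORMAT:
# the inherited growth `e^{½κ₀(1+τ⁻¹)Q}` lives entirely in the extracted Gaussian part `e^{−⟨b,ψ⟩−½⟨ψ,Kψ⟩}`, to be absorbed by the next covariance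
# (dressed column (233)–(256)); what re-enters the polymer road is `e^{−R}` with letters `(2C₃Ψ³, 2C₃Ψ)`.  Pure algebra on `ℂ`; the cubic letter
# itself is (338)'s `cubic_taylor_line` ∕ (339)'s `cubic_taylor_road`, the absorption is the successor's (row NE7b, node U5c; [folklore])

Cell `pub-balaban`, sub-cell `t4`, spine estimate NE7b (`T4WeightBudget.RelWeightBound`; the cell's OWN estimate — NOT PRINTED in
[Bałaban 1983–89], NOT PROVED).  Crux-route work under `Spine/NE7b/` by the row OWNER (`t4-ne7b-p1` gen 135, file (384)) under FREEZE
(0)'s crux-prover clause, on this gen's SCOPING-d7 DECISION (d7′)(2′)(i); NOTHING of Bałaban's is named as a Lean object, valued or asserted; no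
`T4Continuum/Support` leaf typed; no `def`, no notation; zero `sorry`.  Imports (BY NAME): (382) for the road's namespace chain only; Mathlib's
`Complex.norm_exp`, `Complex.re_le_norm` (`Complex.re_le_abs`), `Complex.norm_exp_sub_one_le`.

WHAT IS PROVED ([folklore]):
* `norm_cexp_neg_le` (`‖e^{−z}‖ ≤ e^{‖z‖}`), **`extracted_stability_on_ball`** ((L1): `‖R(ψ)‖ ≤ C₃ΨQ(ψ)` ⟹ `‖e^{−R(ψ)}‖ ≤ e^{½(2C₃Ψ)Q(ψ)}`),
  **`extracted_small_on_ball`** ((S): `‖R(ψ)‖ ≤ C₃Ψ³ ≤ 1` ⟹ `‖e^{−R(ψ)} − 1‖ ≤ 2C₃Ψ³`), `cubic_le_radius_mul_sq` (`C₃Q^{3∕2} ≤ C₃Ψ·Q` on the ball: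
  the two hypotheses from ONE cubic letter `‖R‖ ≤ C₃Q^{3∕2}`), **`extracted_letters_of_cubic`** (both letters from the cubic letter); toy.

HONEST (what this is NOT).  Algebra: the cubic letter's constant `C₃` is (338)'s `(E₃ + 3E₁E₂ + 2E₁³)∕6` (O(1) tilted moments — NOT small in fixed
units; its smallness relative to the input letters is the d = 4 dimensional analysis, unclaimed); the extracted Gaussian's absorption into the next
covariance and the mean shift are untouched; off the ball only (377)'s crude stability is available; scalar skeleton ((A3), NC-NE7b-α UNRULED);
nothing of Bałaban's asserted.  BY-NAME EFFECT ON THE WALL: NONE.  NE7b NOT PRINTED ∕ NOT PROVED; spine PROVED 0∕9; rung (B)+1 — the programme's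
measures remain FINITE-torus statements; NOT the mass gap, NOT Clay.  HONEST DEPENDENCY: continuum YM on T⁴ ⇐ BetaPertH ∧ nine spine estimates
(0∕9 proved); BetaPertH ⇐ (D1) ∧ (D4) ∧ CAP+tail; G-an2-4 gates asym, D1 and NE2∕3∕4.
-/

set_option autoImplicit false

noncomputable section

namespace Summit.QuantumFields.BalabanUV.T4Continuum.NE7b.SupQuadraticExtractionLetters

open Real Finset
open scoped BigOperators

variable {ι : Type} [Fintype ι] [DecidableEq ι] {V : Type*} [DecidableEq V]

omit [Fintype ι] [DecidableEq ι] [DecidableEq V] in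
/-- `‖e^{−z}‖ ≤ e^{‖z‖}`. [folklore] -/
theorem norm_cexp_neg_le (z : ℂ) : ‖Complex.exp (-z)‖ ≤ Real.exp ‖z‖ := by
  rw [Complex.norm_exp]
  exact Real.exp_le_exp.2 ((Complex.re_le_norm _).trans (by rw [norm_neg]))

omit [Fintype ι] [DecidableEq V] in
/-- **(L1) ON THE BALL THE EXTRACTED FACTOR IS STABLE AT RATE `2C₃Ψ`**: `‖R(ψ)‖ ≤ C₃·Ψ·Q(ψ)` ⟹ `‖e^{−R(ψ)}‖ ≤ e^{½(2C₃Ψ)Q(ψ)}`,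
`Q(ψ) = Σ_{x∈cells D}ψ_x²`. [folklore] -/
theorem extracted_stability_on_ball (cell : V → Finset ι) (D : Finset V) {R : EuclideanSpace ℝ ι → ℂ} {C₃ Ψ : ℝ} (ψ : EuclideanSpace ℝ ι)
    (hR : ‖R ψ‖ ≤ C₃ * Ψ * ∑ x ∈ D.biUnion cell, ψ x ^ 2) :
    ‖Complex.exp (-R ψ)‖ ≤ Real.exp ((2 * C₃ * Ψ) * (∑ x ∈ D.biUnion cell, ψ x ^ 2) / 2) := by
  refine (norm_cexp_neg_le (R ψ)).trans (Real.exp_le_exp.2 ?_)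
  linarith

omit [Fintype ι] [DecidableEq ι] [DecidableEq V] in
/-- **(S) ON THE BALL THE EXTRACTED FACTOR IS SMALL**: `‖R(ψ)‖ ≤ C₃Ψ³` with `C₃Ψ³ ≤ 1` ⟹ `‖e^{−R(ψ)} − 1‖ ≤ 2C₃Ψ³`. [folklore] -/
theorem extracted_small_on_ball {R : EuclideanSpace ℝ ι → ℂ} {C₃ Ψ : ℝ} (ψ : EuclideanSpace ℝ ι) (hR : ‖R ψ‖ ≤ C₃ * Ψ ^ 3)
    (h1 : C₃ * Ψ ^ 3 ≤ 1) : ‖Complex.exp (-R ψ) - 1‖ ≤ 2 * (C₃ * Ψ ^ 3) := by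
  have h := Complex.norm_exp_sub_one_le (x := -R ψ) (by rw [norm_neg]; exact hR.trans h1)
  rw [norm_neg] at h
  linarith

omit [Fintype ι] [DecidableEq V] in
/-- **One cubic letter gives both hypotheses on the ball**: `0 ≤ C₃`, `‖R(ψ)‖ ≤ C₃·Q(ψ)^{3∕2}` (as `C₃·√Q·Q`) and `Q(ψ) ≤ Ψ²` with `0 ≤ Ψ` ⟹
`‖R(ψ)‖ ≤ C₃ΨQ(ψ)` and `‖R(ψ)‖ ≤ C₃Ψ³`. [folklore] -/
theorem cubic_le_radius_mul_sq (cell : V → Finset ι) (D : Finset V) {R : EuclideanSpace ℝ ι → ℂ} {C₃ Ψ : ℝ} (hC : 0 ≤ C₃) (hΨ : 0 ≤ Ψ)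
    (ψ : EuclideanSpace ℝ ι) (hR : ‖R ψ‖ ≤ C₃ * Real.sqrt (∑ x ∈ D.biUnion cell, ψ x ^ 2) * ∑ x ∈ D.biUnion cell, ψ x ^ 2)
    (hball : ∑ x ∈ D.biUnion cell, ψ x ^ 2 ≤ Ψ ^ 2) :
    ‖R ψ‖ ≤ C₃ * Ψ * ∑ x ∈ D.biUnion cell, ψ x ^ 2 ∧ ‖R ψ‖ ≤ C₃ * Ψ ^ 3 := by
  have hQ0 : 0 ≤ ∑ x ∈ D.biUnion cell, ψ x ^ 2 := sum_nonneg fun x _ => sq_nonneg (ψ x)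
  have hsq : Real.sqrt (∑ x ∈ D.biUnion cell, ψ x ^ 2) ≤ Ψ := by
    rw [← Real.sqrt_sq hΨ]; exact Real.sqrt_le_sqrt hball
  have h1 : ‖R ψ‖ ≤ C₃ * Ψ * ∑ x ∈ D.biUnion cell, ψ x ^ 2 :=
    hR.trans (mul_le_mul_of_nonneg_right (mul_le_mul_of_nonneg_left hsq hC) hQ0)
  refine ⟨h1, h1.trans ?_⟩
  have := mul_le_mul_of_nonneg_left hball (mul_nonneg hC hΨ)
  calc C₃ * Ψ * ∑ x ∈ D.biUnion cell, ψ x ^ 2 ≤ C₃ * Ψ * Ψ ^ 2 := this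
    _ = C₃ * Ψ ^ 3 := by ring

omit [Fintype ι] [DecidableEq V] in
/-- **THE END — THE EXTRACTED FACTOR'S TWO LETTERS FROM THE CUBIC LETTER**: `0 ≤ C₃`, `0 ≤ Ψ`, `C₃Ψ³ ≤ 1`, the cubic letter on the ball ⟹
(S) `‖e^{−R(ψ)} − 1‖ ≤ 2C₃Ψ³` and (L1) `‖e^{−R(ψ)}‖ ≤ e^{½(2C₃Ψ)Q(ψ)}` for every `ψ` in the ball `Q(ψ) ≤ Ψ²`. [folklore] -/
theorem extracted_letters_of_cubic (cell : V → Finset ι) (D : Finset V) {R : EuclideanSpace ℝ ι → ℂ} {C₃ Ψ : ℝ} (hC : 0 ≤ C₃) (hΨ : 0 ≤ Ψ)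
    (h1 : C₃ * Ψ ^ 3 ≤ 1)
    (hR : ∀ ψ : EuclideanSpace ℝ ι, ∑ x ∈ D.biUnion cell, ψ x ^ 2 ≤ Ψ ^ 2 →
      ‖R ψ‖ ≤ C₃ * Real.sqrt (∑ x ∈ D.biUnion cell, ψ x ^ 2) * ∑ x ∈ D.biUnion cell, ψ x ^ 2)
    (ψ : EuclideanSpace ℝ ι) (hball : ∑ x ∈ D.biUnion cell, ψ x ^ 2 ≤ Ψ ^ 2) :
    ‖Complex.exp (-R ψ) - 1‖ ≤ 2 * (C₃ * Ψ ^ 3) ∧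
      ‖Complex.exp (-R ψ)‖ ≤ Real.exp ((2 * C₃ * Ψ) * (∑ x ∈ D.biUnion cell, ψ x ^ 2) / 2) := by
  obtain ⟨hA, hB⟩ := cubic_le_radius_mul_sq cell D hC hΨ ψ (hR ψ hball) hball
  exact ⟨extracted_small_on_ball ψ hB h1, extracted_stability_on_ball cell D ψ hA⟩

omit [Fintype ι] [DecidableEq ι] [DecidableEq V] in
/-- Toy: the ZERO residual is small (`‖e^0 − 1‖ = 0 ≤ 2·0`) with `C₃ = 0`. -/
example (ψ : EuclideanSpace ℝ ι) : ‖Complex.exp (-(fun _ : EuclideanSpace ℝ ι => (0 : ℂ)) ψ) - 1‖ ≤ 2 * (0 * (1 : ℝ) ^ 3) :=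
  extracted_small_on_ball (R := fun _ => 0) (C₃ := 0) (Ψ := 1) ψ (by simp) (by norm_num)

end Summit.QuantumFields.BalabanUV.T4Continuum.NE7b.SupQuadraticExtractionLetters
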